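import Summits.QuantumFields.YangMills.Theorems.QuantileBitPuritySectorGaugeKernel
import HarnessLib

/-!
# The half-ring kernel `Ψ_j(x,a) = ((K_β^G)^j K_β^G(·,a))(x)`: kernel of the iterated gauge-averaged transfer operator, symmetry, bounds, invariance

Support module (`--supports` stmt-QuantumFields-24093, `QuantileBitPurity.EquatorBandVanishing`; seat ym-dw-p1 g17, LINE g12-B of ideator seat ym-idea-4;
the lattice half of the «flux reflection» lever, companions `QuantileBitPurityFluxReflection*` (abstract Cauchy–Schwarz) and `QuantileBitPurityFlux*`).
With the gauge-averaged bond kernel `K_β^G` (`TT.gaugeKernel`, module `QuantileBitPuritySectorGaugeKernel`) and its pointwise operator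
`(T^G f)(U) = ∫ K_β^G(U,V) f(V) dV`, the ITERATED SECTION `Ψ_j(x,a) := ((T^G)^j K_β^G(·,a))(x)` (the tree's `measurable_iterate_gaugeKernel_section` object)
is the kernel of `(T^G)^{j+1}`:

* ★ `iterate_succ_apply_eq_integral_section` — `((T^G)^{j+1} f)(x) = ∫ Ψ_j(x,a) f(a) da` for bounded measurable `f` (Fubini, induction on `j`);
* ★ `iterate_section_symm` — `Ψ_j(x,a) = Ψ_j(a,x)` (symmetry of `K_β^G`, induction with the kernel formula);
* `iterate_section_nonneg`, `abs_iterate_section_le` (`0 ≤ Ψ_j ≤ M^{j+1}`), `iterate_section_gaugeTransform_left/right` (gauge invariance in each slot),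
  `measurable_iterate_section_uncurry` (joint measurability), and ★ `integral_transferKernel_iterate_eq` — on a gauge-invariant bounded measurable `f` the
  PLAIN transfer operator iterate is given by the same kernel: `(T^{j+1} f)(x) = ∫ Ψ_j(x,a) f(a) da` (tree `integral_gaugeKernel_mul_of_gaugeInv`,
  `iterate_gaugeKernelOp_eq`).

HONEST FRAMING: fixed-lattice transfer-matrix bookkeeping; nothing about infinite volume, the continuum limit or the Clay gap.  No `sorry`, no new axiom,
no new definition.  References: [cite: SeilerLNP1982, §3]; [cite: Luscher1983, §2].
-/

set_option autoImplicit false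

noncomputable section

open MeasureTheory Filter Topology Real Function
open scoped BigOperators
open Literature.MathematicalPhysics.QuantumLattice
open Literature.MathematicalPhysics.QuantumFieldTheory hiding SU2
open Literature.Analysis.OperatorTheory
open Summit.QuantumFields.YangMills.Theorems

namespace Summit.QuantumFields.YangMills.Theorems.FemtoTransferGap.TT

open Summit.QuantumFields.YangMills.Theorems.FemtoTransferGap

variable {L : ℕ} [NeZero L]

/-! ## §1 Pointwise properties of the iterated section -/

/-- **Right gauge invariance**: `Ψ_j(x, g·a) = Ψ_j(x, a)` (the seed `K^G(·, g·a) = K^G(·, a)`). [cite: SeilerLNP1982, §3] -/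
theorem iterate_section_gaugeTransform_right (β : ℝ) (j : ℕ) (g : Site 3 L → SU2) (x a : GaugeConfig 3 L SU2) :
    ((fun f : GaugeConfig 3 L SU2 → ℝ => fun U => ∫ V, gaugeKernel β U V * f V ∂configMeasure SU2 L)^[j]
        (fun w => gaugeKernel β w (gaugeTransform g a))) x =
      ((fun f : GaugeConfig 3 L SU2 → ℝ => fun U => ∫ V, gaugeKernel β U V * f V ∂configMeasure SU2 L)^[j]
        (fun w => gaugeKernel β w a)) x := by
  have h : (fun w : GaugeConfig 3 L SU2 => gaugeKernel β w (gaugeTransform g a)) = fun w => gaugeKernel β w a :=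
    funext fun w => gaugeKernel_gaugeTransform_right β g w a
  rw [h]

/-- The seed section `K^G(·,a)` is measurable, bounded by the kernel bound and gauge invariant. [folklore] -/
theorem seed_section_props {β M : ℝ} (hM : ∀ U V : GaugeConfig 3 L SU2, |transferKernel su2Rep β U V| ≤ M) (a : GaugeConfig 3 L SU2) :
    Measurable (fun w : GaugeConfig 3 L SU2 => gaugeKernel β w a) ∧ (∀ w, |gaugeKernel β w a| ≤ M) ∧
      ∀ (g : Site 3 L → SU2) (w : GaugeConfig 3 L SU2), gaugeKernel β (gaugeTransform g w) a = gaugeKernel β w a := by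
  refine ⟨?_, fun w => abs_gaugeKernel_le hM w a, fun g w => gaugeKernel_gaugeTransform_left β g w a⟩
  have h : (fun w : GaugeConfig 3 L SU2 => gaugeKernel β w a) = fun w => gaugeKernel β a w := funext fun w => gaugeKernel_symm β w a
  rw [h]; exact measurable_gaugeKernel_right β a

/-- The iterated section is measurable in the argument and gauge invariant there (tree `iterate_gaugeKernelOp_eq` on the invariant seed).
[cite: Luscher1983, §2] -/
theorem iterate_section_measurable_gaugeTransform_left {β M : ℝ} (hM : ∀ U V : GaugeConfig 3 L SU2, |transferKernel su2Rep β U V| ≤ M) (j : ℕ)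
    (a : GaugeConfig 3 L SU2) :
    Measurable (((fun f : GaugeConfig 3 L SU2 → ℝ => fun U => ∫ V, gaugeKernel β U V * f V ∂configMeasure SU2 L)^[j]) (fun w => gaugeKernel β w a)) ∧
    ∀ (g : Site 3 L → SU2) (x : GaugeConfig 3 L SU2),
      ((fun f : GaugeConfig 3 L SU2 → ℝ => fun U => ∫ V, gaugeKernel β U V * f V ∂configMeasure SU2 L)^[j]) (fun w => gaugeKernel β w a) (gaugeTransform g x) =
        ((fun f : GaugeConfig 3 L SU2 → ℝ => fun U => ∫ V, gaugeKernel β U V * f V ∂configMeasure SU2 L)^[j]) (fun w => gaugeKernel β w a) x := by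
  obtain ⟨hm, hb, hg⟩ := seed_section_props (L := L) hM a
  obtain ⟨h1, h2, -, h4⟩ := iterate_gaugeKernelOp_eq (L := L) β hm hb hg j
  refine ⟨?_, ?_⟩
  · rw [h1]; exact h2
  · intro g x; rw [h1]; exact h4 g x

/-- **Non-negativity and the explicit bound** `0 ≤ Ψ_j(x,a) ≤ M^{j+1}` (`K_β^G ≥ 0`, a-priori probability measure). [folklore] -/
theorem iterate_section_nonneg_le {β M : ℝ} (hM : ∀ U V : GaugeConfig 3 L SU2, |transferKernel su2Rep β U V| ≤ M) (j : ℕ) :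
    ∀ (a x : GaugeConfig 3 L SU2),
      0 ≤ ((fun f : GaugeConfig 3 L SU2 → ℝ => fun U => ∫ V, gaugeKernel β U V * f V ∂configMeasure SU2 L)^[j] (fun w => gaugeKernel β w a)) x ∧
        ((fun f : GaugeConfig 3 L SU2 → ℝ => fun U => ∫ V, gaugeKernel β U V * f V ∂configMeasure SU2 L)^[j] (fun w => gaugeKernel β w a)) x ≤ M ^ (j + 1) := by
  induction j with
  | zero =>
    intro a x
    simp only [Function.iterate_zero, id_eq, zero_add, pow_one]
    exact ⟨gaugeKernel_nonneg β x a, (le_abs_self _).trans (abs_gaugeKernel_le hM x a)⟩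
  | succ j ih =>
    intro a x
    rw [Function.iterate_succ_apply']
    refine ⟨integral_nonneg fun V => mul_nonneg (gaugeKernel_nonneg β x V) (ih a V).1, ?_⟩
    have h := norm_integral_le_of_norm_le_const (μ := configMeasure SU2 L)
      (f := fun V => gaugeKernel β x V * ((fun f : GaugeConfig 3 L SU2 → ℝ => fun U => ∫ V, gaugeKernel β U V * f V ∂configMeasure SU2 L)^[j]
        (fun w => gaugeKernel β w a)) V) (C := M * M ^ (j + 1)) (ae_of_all _ fun V => by
          rw [Real.norm_eq_abs, abs_mul, abs_of_nonneg (ih a V).1]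
          exact mul_le_mul (abs_gaugeKernel_le hM x V) (ih a V).2 (ih a V).1 ((abs_nonneg _).trans (abs_gaugeKernel_le hM x V)))
    rw [probReal_univ, mul_one, Real.norm_eq_abs] at h
    calc _ ≤ |∫ V, gaugeKernel β x V * ((fun f : GaugeConfig 3 L SU2 → ℝ => fun U => ∫ V, gaugeKernel β U V * f V ∂configMeasure SU2 L)^[j]
          (fun w => gaugeKernel β w a)) V ∂configMeasure SU2 L| := le_abs_self _
      _ ≤ M * M ^ (j + 1) := h
      _ = M ^ (j + 1 + 1) := by ring

/-- **Joint measurability** of `(x, a) ↦ Ψ_j(x,a)` (the tree's `measurable_iterate_gaugeKernel_section`, slots swapped). [folklore] -/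
theorem measurable_iterate_section_uncurry (β : ℝ) (j : ℕ) :
    Measurable (uncurry fun x a : GaugeConfig 3 L SU2 =>
      ((fun f : GaugeConfig 3 L SU2 → ℝ => fun U => ∫ V, gaugeKernel β U V * f V ∂configMeasure SU2 L)^[j] (fun w => gaugeKernel β w a)) x) := by
  have h := (measurable_iterate_gaugeKernel_section (L := L) β j).comp
    (measurable_snd.prodMk measurable_fst : Measurable fun p : GaugeConfig 3 L SU2 × GaugeConfig 3 L SU2 => (p.2, p.1))
  exact h

/-! ## §2 The kernel of the iterated operator and the symmetry of the iterated section -/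

/-- ★ **Kernel of `(T^G)^{j+1}`**: for bounded measurable `f`, `((T^G)^{j+1} f)(x) = ∫ Ψ_j(x,a) f(a) da`. [cite: SeilerLNP1982, §3] -/
theorem iterate_succ_apply_eq_integral_section {β M : ℝ} (hM : ∀ U V : GaugeConfig 3 L SU2, |transferKernel su2Rep β U V| ≤ M) (j : ℕ) :
    ∀ {f : GaugeConfig 3 L SU2 → ℝ}, Measurable f → ∀ {C : ℝ}, (∀ a, |f a| ≤ C) → ∀ x : GaugeConfig 3 L SU2,
      ((fun f : GaugeConfig 3 L SU2 → ℝ => fun U => ∫ V, gaugeKernel β U V * f V ∂configMeasure SU2 L)^[j + 1]) f x =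
        ∫ a, ((fun f : GaugeConfig 3 L SU2 → ℝ => fun U => ∫ V, gaugeKernel β U V * f V ∂configMeasure SU2 L)^[j]
          (fun w => gaugeKernel β w a)) x * f a ∂configMeasure SU2 L := by
  induction j with
  | zero =>
    intro f _ C _ x
    simp only [Function.iterate_zero, id_eq, zero_add, Function.iterate_one]
  | succ j ih =>
    intro f hf C hfb x
    rw [Function.iterate_succ_apply']
    -- `(T^G ((T^G)^{j+1} f))(x) = ∫ K^G(x,w) ∫ Ψ_j(w,a) f(a) da dw`
    have h1 : ∫ w, gaugeKernel β x w *
        ((fun f : GaugeConfig 3 L SU2 → ℝ => fun U => ∫ V, gaugeKernel β U V * f V ∂configMeasure SU2 L)^[j + 1]) f w ∂configMeasure SU2 L =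
        ∫ w, gaugeKernel β x w * ∫ a, ((fun f : GaugeConfig 3 L SU2 → ℝ => fun U => ∫ V, gaugeKernel β U V * f V ∂configMeasure SU2 L)^[j]
          (fun w' => gaugeKernel β w' a)) w * f a ∂configMeasure SU2 L ∂configMeasure SU2 L :=
      integral_congr_ae (ae_of_all _ fun w => by dsimp only; rw [ih hf hfb w])
    rw [h1]
    -- Fubini: swap and recognise `Ψ_{j+1}(x,a) = ∫ K^G(x,w) Ψ_j(w,a) dw`
    have hKG := (stronglyMeasurable_gaugeKernel (L := L) β).measurable
    have hΨ := measurable_iterate_section_uncurry (L := L) β j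
    have hKGb : ∀ U V : GaugeConfig 3 L SU2, ‖gaugeKernel β U V‖ ≤ M := fun U V => by rw [Real.norm_eq_abs]; exact abs_gaugeKernel_le hM U V
    have hΨb : ∀ w a : GaugeConfig 3 L SU2, ‖((fun f : GaugeConfig 3 L SU2 → ℝ => fun U => ∫ V, gaugeKernel β U V * f V ∂configMeasure SU2 L)^[j]
        (fun w' => gaugeKernel β w' a)) w‖ ≤ M ^ (j + 1) := fun w a => by
      rw [Real.norm_eq_abs, abs_of_nonneg (iterate_section_nonneg_le hM j a w).1]; exact (iterate_section_nonneg_le hM j a w).2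
    have hfb' : ∀ a, ‖f a‖ ≤ C := fun a => by rw [Real.norm_eq_abs]; exact hfb a
    rw [integral_kernel_mul_integral_kernel_mul (ρ := configMeasure SU2 L) hKG hΨ hKGb hΨb hf hfb' x]
    refine integral_congr_ae (ae_of_all _ fun a => ?_)
    dsimp only
    rw [Function.iterate_succ_apply']

/-- ★ **Symmetry** `Ψ_j(x,a) = Ψ_j(a,x)`. [cite: SeilerLNP1982, §3] -/
theorem iterate_section_symm {β M : ℝ} (hM : ∀ U V : GaugeConfig 3 L SU2, |transferKernel su2Rep β U V| ≤ M) (j : ℕ) :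
    ∀ x a : GaugeConfig 3 L SU2,
      ((fun f : GaugeConfig 3 L SU2 → ℝ => fun U => ∫ V, gaugeKernel β U V * f V ∂configMeasure SU2 L)^[j] (fun w => gaugeKernel β w a)) x =
        ((fun f : GaugeConfig 3 L SU2 → ℝ => fun U => ∫ V, gaugeKernel β U V * f V ∂configMeasure SU2 L)^[j] (fun w => gaugeKernel β w x)) a := by
  induction j with
  | zero => intro x a; simp only [Function.iterate_zero, id_eq]; exact gaugeKernel_symm β x a
  | succ j ih =>
    intro x a
    obtain ⟨hm, hb, -⟩ := seed_section_props (L := L) hM x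
    -- right side through the kernel formula: `Ψ_{j+1}(a,x) = ∫ Ψ_j(a,y) K^G(y,x) dy`
    rw [iterate_succ_apply_eq_integral_section hM j hm hb a]
    -- left side: `Ψ_{j+1}(x,a) = ∫ K^G(x,y) Ψ_j(y,a) dy`
    rw [Function.iterate_succ_apply']
    refine integral_congr_ae (ae_of_all _ fun y => ?_)
    dsimp only
    rw [ih y a, gaugeKernel_symm β x y, mul_comm]

/-- ★ **The plain transfer iterate on gauge-invariant functions has the same kernel**: for bounded measurable gauge-invariant `f`,
`(T^{j+1} f)(x) = ∫ Ψ_j(x,a) f(a) da` with `(T f)(U) = ∫ K_β(U,V) f(V) dV`. [cite: Luscher1983, §2] -/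
theorem integral_transferKernel_iterate_eq {β M : ℝ} (hM : ∀ U V : GaugeConfig 3 L SU2, |transferKernel su2Rep β U V| ≤ M) (j : ℕ)
    {f : GaugeConfig 3 L SU2 → ℝ} (hf : Measurable f) {C : ℝ} (hfb : ∀ a, |f a| ≤ C)
    (hfg : ∀ (g : Site 3 L → SU2) (U : GaugeConfig 3 L SU2), f (gaugeTransform g U) = f U) (x : GaugeConfig 3 L SU2) :
    ((fun f : GaugeConfig 3 L SU2 → ℝ => fun U => ∫ V, transferKernel su2Rep β U V * f V ∂configMeasure SU2 L)^[j + 1]) f x =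
      ∫ a, ((fun f : GaugeConfig 3 L SU2 → ℝ => fun U => ∫ V, gaugeKernel β U V * f V ∂configMeasure SU2 L)^[j]
        (fun w => gaugeKernel β w a)) x * f a ∂configMeasure SU2 L := by
  rw [← (iterate_gaugeKernelOp_eq (L := L) β hf hfb hfg (j + 1)).1]
  exact iterate_succ_apply_eq_integral_section hM j hf hfb x

end Summit.QuantumFields.YangMills.Theorems.FemtoTransferGap.TT

end
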